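import Summits.BirchSwinnertonDyer.BirchSwinnertonDyer.Theorems.TeichmullerTwistDescentTameGoodModelOfTateProfile
import HarnessLib

/-!
# Route `TeichmullerTwistDescent`: the Néron jump of a POTENTIALLY GOOD curve at `p ≥ 5` is `ord_p Δ_min / 12` —
# `HasTameGoodModel p e W a` whenever `12a = e·ord_p Δ_min` and `ord_p j ≥ 0`, uniformly in the Kodaira type
# (`--supports` PSMU, stmt-BirchSwinnertonDyer-22638; route-independent module)

Cell `pub/bsd-wall`, D-0145 line `route-BirchSwinnertonDyer-TeichmullerTwistDescent`, seat `bsd-line-ttd-p1` g15.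
BSD is NOT proved by this; Manin's conjecture is not proved by this; no route item is closed. THEOREMS ONLY; imports
no route file.

## What is proved

**`hasTameGoodModel_of_padicValRat_j_nonneg`**: `p ≥ 5` prime, `W/ℚ` elliptic and globally minimal with
`ord_p j(W) ≥ 0` (potentially good reduction at `p`), `e ≥ 1` and `a` with `12a = e·ord_p Δ_min(W)`. Then
`HasTameGoodModel p e W a`: over `K = ℚ(ϖ)`, `ϖ^e = −p`, the curve has good reduction with Néron differential
`ϖ^a·ω_W` — the jump `a/e = ord_p Δ_min/12` for EVERY tame Kodaira type at once (II `1/6`, III `1/4`, IV `1/3`,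
I₀* `1/2`, IV* `2/3`, III* `3/4`, II* `5/6`; Edixhoven–Manin 1991 Prop. 4), which is the «Néron jump» of the TTD
thesis («Gauss-sum valuation = Néron jump `a/e`», memo MECHANISM-K-lattice §4, item K4 — its geometric half), and the
hypothesis under which the carrier `TameNeronFormsAt N p e` (N38b/N38c) turns `p ∤ c` into `col_K ≤ a` on TTD's rows.

## Proof (no Tate algorithm)

At `p ≥ 5` the depressed model `C₀ • W : y² = x³ − (c₄/48)x − c₆/864` (`C₀ = (1, −b₂/12, −a₁/2, ·)`) is `p`-integral
with the same discriminant. With `d = ord_p Δ`: `ord_p j ≥ 0` is `3·ord_p c₄ ≥ d` (or `c₄ = 0`), and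
`c₆² = c₄³ − 1728Δ` then gives `2·ord_p c₆ ≥ d` (or `c₆ = 0`). Hence the Tate profile `(∞, ∞, ∞, ord_p c₄, ord_p c₆; d)`
satisfies `4a ≤ e·ord_p c₄`, `6a ≤ e·ord_p c₆` as soon as `12a = e·d`, and `hasTameGoodModel_of_tateProfile`
(p699596: rigidity + rescaling by `ϖ^a u₀⁻¹`) concludes. Axioms `propext`, `Classical.choice`, `Quot.sound`.

References: [SilvermanAEC2009] III §1 (the `c₄, c₆` model), VII.5 Prop. 5.1, 5.5; [EdixhovenManin1991] Prop. 4;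
[Serre1972] §5.6 (`e = 12/gcd(12, ord_p Δ)`).
-/

set_option autoImplicit false
-- D-0017: single-problem summit, so `Summit.BirchSwinnertonDyer.BirchSwinnertonDyer.…` repeats a namespace BY DESIGN.
set_option linter.dupNamespace false

noncomputable section

open scoped Classical

open WeierstrassCurve IsDedekindDomain IsDedekindDomain.HeightOneSpectrum Rat.HeightOneSpectrum WithZero
  Literature.NumberTheory.EllipticCurves Literature.NumberTheory.EllipticCurves.ModularForms
  Literature.NumberTheory.DiophantineGeometry Summit.BirchSwinnertonDyer.Rank1Residual.Additive

namespace Summit.BirchSwinnertonDyer.BirchSwinnertonDyer.Theorems.TeichmullerTwistDescent.TameGoodModel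

variable (p : ℕ) [hp : Fact p.Prime]

/-- From «`x ≠ 0 ⇒ i·a ≤ e·ord_p x` and `ord_p x ≥ 0`» to a profile index `k` with `|x|_{(p)} ≤ exp(−k)` and
`i·a ≤ e·k` (`k = ord_p x`, or `k = i·a` when `x = 0`). [folklore] -/
theorem exists_profile_index {x : ℚ} {i a e : ℕ} (he : 0 < e) (hx0 : x ≠ 0 → 0 ≤ padicValRat p x)
    (hx : x ≠ 0 → ((i * a : ℕ) : ℤ) ≤ e * padicValRat p x) :
    ∃ k : ℕ, (placeOf p).valuation ℚ x ≤ exp (-(k : ℤ)) ∧ i * a ≤ e * k := by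
  rcases eq_or_ne x 0 with rfl | h0
  · exact ⟨i * a, by simp, Nat.le_mul_of_pos_left _ he⟩
  · refine ⟨(padicValRat p x).toNat, ?_, ?_⟩
    · rw [valuation_placeOf_eq p h0, exp_le_exp, Int.toNat_of_nonneg (hx0 h0)]
    · have h1 := hx h0
      have h2 : ((padicValRat p x).toNat : ℤ) = padicValRat p x := Int.toNat_of_nonneg (hx0 h0)
      have : ((i * a : ℕ) : ℤ) ≤ ((e * (padicValRat p x).toNat : ℕ) : ℤ) := by push_cast; rw [h2]; exact_mod_cast h1
      exact_mod_cast this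

/-- **The Néron jump of a potentially good curve at `p ≥ 5` is `ord_p Δ_min/12`.** For `p ≥ 5`, `W/ℚ` elliptic and
globally minimal with `0 ≤ ord_p j(W)`, and `e ≥ 1`, `a` with `12a = e·ord_p Δ_min(W)`: `HasTameGoodModel p e W a`.
[cite: EdixhovenManin1991, Prop. 4 (the Néron jumps a/n of the six additive potentially good types)]
[cite: SilvermanAEC2009, III §1 and VII.5 Prop. 5.5] -/
theorem hasTameGoodModel_of_padicValRat_j_nonneg (hp5 : 5 ≤ p) (W : WeierstrassCurve ℚ) [W.IsElliptic]
    [W.IsGloballyMinimal] (hj : 0 ≤ padicValRat p W.j) {e a : ℕ} (he : 0 < e)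
    (h12 : 12 * a = e * padicValInt p W.minimalDiscriminantInt) : HasTameGoodModel p e W a := by
  have hpP : p.Prime := hp.out
  set d := padicValInt p W.minimalDiscriminantInt with hd
  -- the depressed model `y² = x³ − (c₄/48) x − c₆/864`
  set C₀ : VariableChange ℚ := ⟨1, -W.b₂ / 12, -W.a₁ / 2, -(W.a₃ + (-W.b₂ / 12) * W.a₁) / 2⟩ with hC₀
  have hu : ((C₀.u⁻¹ : ℚˣ) : ℚ) = 1 := by simp [hC₀]
  have e₁ : (C₀ • W).a₁ = 0 := by
    rw [variableChange_a₁, hu]; simp only [hC₀]; ring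
  have e₂ : (C₀ • W).a₂ = 0 := by
    rw [variableChange_a₂, hu]; simp only [hC₀, WeierstrassCurve.b₂]; ring
  have e₃ : (C₀ • W).a₃ = 0 := by
    rw [variableChange_a₃, hu]; simp only [hC₀]; ring
  have e₄ : (C₀ • W).a₄ = -W.c₄ / 48 := by
    rw [variableChange_a₄, hu]
    simp only [hC₀, WeierstrassCurve.c₄, WeierstrassCurve.b₂, WeierstrassCurve.b₄]; ring
  have e₆ : (C₀ • W).a₆ = -W.c₆ / 864 := by
    rw [variableChange_a₆, hu]
    simp only [hC₀, WeierstrassCurve.c₆, WeierstrassCurve.b₂, WeierstrassCurve.b₄, WeierstrassCurve.b₆]; ring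
  have eΔ : (C₀ • W).Δ = W.Δ := by rw [variableChange_Δ, hu, one_pow, one_mul]
  -- valuations: `d = ord_p Δ`, `3 ord_p c₄ ≥ d` (or `c₄ = 0`), `2 ord_p c₆ ≥ d` (or `c₆ = 0`)
  have hΔ0 : W.Δ ≠ 0 := W.Δ'.ne_zero
  have vΔ : padicValRat p W.Δ = d := by
    rw [← cast_minimalDiscriminantInt W, padicValRat.of_int]
  have hZ : (W.integralModelInt).map (Int.castRingHom ℚ) = W := map_integralModelInt W
  have vc4 : 0 ≤ padicValRat p W.c₄ := by
    rw [← hZ, map_c₄, eq_intCast, padicValRat.of_int]; positivity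
  have vc6 : 0 ≤ padicValRat p W.c₆ := by
    rw [← hZ, map_c₆, eq_intCast, padicValRat.of_int]; positivity
  have h48 : padicValRat p (48 : ℚ) = 0 := by
    rw [show (48 : ℚ) = ((48 : ℕ) : ℚ) by norm_num, padicValRat.of_nat, Nat.cast_eq_zero,
      padicValNat.eq_zero_of_not_dvd]
    intro h
    have : p ≤ 3 := by
      have h' : p ∣ 2 ^ 4 * 3 := by simpa using h
      rcases (Nat.Prime.dvd_mul hpP).mp h' with h2 | h3
      · exact (Nat.le_of_dvd two_pos (hpP.dvd_of_dvd_pow h2)).trans (by norm_num)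
      · exact Nat.le_of_dvd three_pos h3
    omega
  have h864 : padicValRat p (864 : ℚ) = 0 := by
    rw [show (864 : ℚ) = ((864 : ℕ) : ℚ) by norm_num, padicValRat.of_nat, Nat.cast_eq_zero,
      padicValNat.eq_zero_of_not_dvd]
    intro h
    have : p ≤ 3 := by
      have h' : p ∣ 2 ^ 5 * 3 ^ 3 := by simpa using h
      rcases (Nat.Prime.dvd_mul hpP).mp h' with h2 | h3
      · exact (Nat.le_of_dvd two_pos (hpP.dvd_of_dvd_pow h2)).trans (by norm_num)
      · exact Nat.le_of_dvd three_pos (hpP.dvd_of_dvd_pow h3)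
    omega
  have h1728 : padicValRat p (1728 : ℚ) = 0 := by
    rw [show (1728 : ℚ) = 48 * (48 * 3 / 4) by norm_num]
    rw [show (48 * (48 * 3 / 4) : ℚ) = 2 * 864 by norm_num, padicValRat.mul two_ne_zero (by norm_num), h864,
      add_zero, show (2 : ℚ) = ((2 : ℕ) : ℚ) by norm_num, padicValRat.of_nat, Nat.cast_eq_zero,
      padicValNat.eq_zero_of_not_dvd]
    intro h; have := Nat.le_of_dvd two_pos h; omega
  -- `3·ord_p c₄ ≥ d` from `ord_p j ≥ 0`
  have hc4 : W.c₄ ≠ 0 → (d : ℤ) ≤ 3 * padicValRat p W.c₄ := by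
    intro h0
    have hj' : padicValRat p W.j = 3 * padicValRat p W.c₄ - padicValRat p W.Δ := by
      rw [WeierstrassCurve.j, Units.val_inv_eq_inv_val, coe_Δ', padicValRat.mul (inv_ne_zero hΔ0) (pow_ne_zero 3 h0),
        padicValRat.inv, padicValRat.pow]
      ring
    rw [hj', vΔ] at hj
    linarith
  -- `2·ord_p c₆ ≥ d` from `c₆² = c₄³ − 1728Δ`
  have hc6 : W.c₆ ≠ 0 → (d : ℤ) ≤ 2 * padicValRat p W.c₆ := by
    intro h0
    have hrel : W.c₆ ^ 2 = W.c₄ ^ 3 + (-1728 * W.Δ) := by linear_combination W.c_relation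
    have hne : W.c₄ ^ 3 + (-1728 * W.Δ) ≠ 0 := by rw [← hrel]; exact pow_ne_zero 2 h0
    have hvΔ' : padicValRat p (-1728 * W.Δ) = d := by
      rw [padicValRat.mul (by norm_num) hΔ0, padicValRat.neg, h1728, vΔ, zero_add]
    have h2 : 2 * padicValRat p W.c₆ = padicValRat p (W.c₄ ^ 3 + (-1728 * W.Δ)) := by
      rw [← hrel, padicValRat.pow]; push_cast; ring
    rcases eq_or_ne W.c₄ 0 with h40 | h40
    · rw [h2, h40, zero_pow three_ne_zero, zero_add, hvΔ']
    · have hmin := padicValRat.min_le_padicValRat_add (p := p) hne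
      rw [padicValRat.pow, hvΔ'] at hmin
      have h3 := hc4 h40
      rw [h2]
      push_cast at hmin
      exact le_trans (by exact le_min (by linarith) le_rfl) hmin
  -- the profile indices
  obtain ⟨k₁, c₁, hk₁⟩ := exists_profile_index p (x := (C₀ • W).a₁) (i := 1) (a := a) he
    (fun h ↦ absurd e₁ h) (fun h ↦ absurd e₁ h)
  obtain ⟨k₂, c₂, hk₂⟩ := exists_profile_index p (x := (C₀ • W).a₂) (i := 2) (a := a) he
    (fun h ↦ absurd e₂ h) (fun h ↦ absurd e₂ h)
  obtain ⟨k₃, c₃, hk₃⟩ := exists_profile_index p (x := (C₀ • W).a₃) (i := 3) (a := a) he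
    (fun h ↦ absurd e₃ h) (fun h ↦ absurd e₃ h)
  obtain ⟨k₄, c₄', hk₄⟩ := exists_profile_index p (x := (C₀ • W).a₄) (i := 4) (a := a) he
    (by
      intro h
      have h0 : W.c₄ ≠ 0 := by intro h0; exact h (by rw [e₄, h0]; simp)
      rw [e₄, padicValRat.div (neg_ne_zero.mpr h0) (by norm_num), padicValRat.neg, h48]; linarith)
    (by
      intro h
      have h0 : W.c₄ ≠ 0 := by intro h0; exact h (by rw [e₄, h0]; simp)
      rw [e₄, padicValRat.div (neg_ne_zero.mpr h0) (by norm_num), padicValRat.neg, h48, sub_zero]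
      have := hc4 h0
      have h12' : ((12 * a : ℕ) : ℤ) = e * d := by exact_mod_cast h12
      push_cast at h12' ⊢
      nlinarith)
  obtain ⟨k₆, c₆', hk₆⟩ := exists_profile_index p (x := (C₀ • W).a₆) (i := 6) (a := a) he
    (by
      intro h
      have h0 : W.c₆ ≠ 0 := by intro h0; exact h (by rw [e₆, h0]; simp)
      rw [e₆, padicValRat.div (neg_ne_zero.mpr h0) (by norm_num), padicValRat.neg, h864]; linarith)
    (by
      intro h
      have h0 : W.c₆ ≠ 0 := by intro h0; exact h (by rw [e₆, h0]; simp)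
      rw [e₆, padicValRat.div (neg_ne_zero.mpr h0) (by norm_num), padicValRat.neg, h864, sub_zero]
      have := hc6 h0
      have h12' : ((12 * a : ℕ) : ℤ) = e * d := by exact_mod_cast h12
      push_cast at h12' ⊢
      nlinarith)
  have cΔ : (placeOf p).valuation ℚ (C₀ • W).Δ = exp (-(d : ℤ)) := by
    rw [eΔ, valuation_placeOf_Δ_eq p W]
  exact hasTameGoodModel_of_tateProfile p he W C₀ c₁ c₂ c₃ c₄' c₆' cΔ rfl
    (by simpa using hk₁) hk₂ hk₃ hk₄ hk₆ h12

end Summit.BirchSwinnertonDyer.BirchSwinnertonDyer.Theorems.TeichmullerTwistDescent.TameGoodModel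

end
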